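import Mathlib
import Summits.NavierStokesRegularity.NavierStokesRegularity.Theses.LocalPressureProfileDoor
import HarnessLib

/-!
# `LocalPressureProfileDoor.Assembly` — the route's assembly (item stmt-NavierStokesRegularity-20182;
  pure logic)

**Statement.** `LocalPointZoomSimilarityPressure → MonotonePressureProfileRigidity → Target`.

PROOF. The route file `Theses/LocalPressureProfileDoor.lean` carries the planner-authored,
kernel-checked deciding theorem `Theses.LocalPressureProfileDoor.closes`, whose hypotheses are exactly
the route's two cruxes and whose conclusion is the registered leaf `Target`; the assembly item is that
implication written as ONE proposition, so it is closed by applying `closes` to the hypotheses.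

HONEST FRAMING: glue between the route's own statements (about HYPOTHETICAL objects); nothing
here bears on the regularity problem itself.
-/

noncomputable section

set_option linter.dupNamespace false

namespace Summit.NavierStokesRegularity.NavierStokesRegularity.Theorems

open Summit.NavierStokesRegularity.NavierStokesRegularity.Theses.LocalPressureProfileDoor in
/-- **Item stmt-NavierStokesRegularity-20182** (`LocalPressureProfileDoor.Assembly`): the route's two
cruxes imply its registered leaf `Target`, by the route file's deciding theorem `closes`. [this file] -/
theorem localPressureProfileDoor_assembly_proof :
    Summit.NavierStokesRegularity.NavierStokesRegularity.Theses.LocalPressureProfileDoor.Assembly := by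
  unfold Summit.NavierStokesRegularity.NavierStokesRegularity.Theses.LocalPressureProfileDoor.Assembly
  intro h₁ h₂
  exact closes h₁ h₂

end Summit.NavierStokesRegularity.NavierStokesRegularity.Theorems

end
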